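import Summits.BirchSwinnertonDyer.Rank1Residual.X11b.ZpLineIndexTorsion
import Summits.BirchSwinnertonDyer.Rank1Residual.X11b.BDPRouteLocalIndex
import Literature.NumberTheory.EllipticCurves.BSDRootNumberSmallConductorProofs
import HarnessLib

/-!
# Local bookkeeping on `E(ℚ_p)`: `[E(ℚ_p) : E⁽²⁾(ℚ_p)] = c_p · #Ẽ_ns(𝔽_p) · p`, `#Ẽ_ns(𝔽_p) = p` at ADDITIVE
# reduction, the torsion of `E(ℚ_p)` is finite and `#E(ℚ_p)[p^∞] = p^{v_p #E(ℚ_p)_tors}` (cell `b2b-bsdres`,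
# team n1011, row T-R1-24 = ROUTE-1 §20.8 R1-24; seat n1011-p05 gen 3 — the def-free half of
# `Additive/PadicLogImage.lean`, shared with `Additive/LocalTorsionExponent.lean`)

HONEST FRAMING (cell `b2b-bsdres`, run/shared/lean/b2b/bsd-rank1-residual/, verbatim in every
file): the goal of the cell is to DELETE the COMBINATION-SHAPED residual classes of the
Birch–Swinnerton-Dyer formula for ALL analytic-rank `≤ 1` elliptic curves over `ℚ` — "full BSD
formula for every rank `≤ 1` curve in class `C`" assembled STRICTLY from published theorems — so
that the rank-`≤ 1` remainder becomes exactly the CONSTRUCTION-SHAPED classes, which are TYPED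
(missing-input `Prop`s), NOT attempted. This is not "finishing BSD". Team n1011 (X4 ∧ `p = 3`,
§I N10/N11; ROUTE-1 (a′) of planner r1): research route; TOOL theorems on local points only; no
definition, no named fact; nothing booked; no label changes.

## What

For an elliptic `X/ℚ_p` (`p`-integral, resp. `ℤ_p`-minimal, resp. of additive reduction):

* `index_formalFiltration_two_ne_zero`, `finite_torsion_point` — `[E(ℚ_p) : E⁽²⁾(ℚ_p)]` is finite
  non-zero and `E(ℚ_p)_tors` is finite (x11b `LocalIndex.finite_torsion` along `E⁽²⁾(ℚ_p) ≅ ℤ_p`);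
* **`natCard_primaryComponent_point_eq_pow` — `#E(ℚ_p)[p^∞] = p^t`, `t := v_p #E(ℚ_p)_tors`** (Kim's
  `p^t = #H⁰(ℚ_p, E[p^∞])`, AJM 148 Lemma 3.10; Mathlib `AddCommGroup.primaryComponent`; tree
  `card_addPrimaryComponent_eq_pow` + x11b `natCard_primaryComponent_torsion`);
* `index_formalFiltration_two_eq` — **`[E(ℚ_p) : E⁽²⁾(ℚ_p)] = c_p · #Ẽ_ns(𝔽_p) · p`** (tree
  `index_formalFiltration`), `localTamagawaNumber_ne_zero_and_natCard_point_reduction_ne_zero`,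
  `padicValNat_index_formalFiltration_two`;
* `reduction_Δ_eq_zero_and_c₄_eq_zero_of_hasAdditiveReduction` (the reduction is a CUSP) and
  **`natCard_point_reduction_of_hasAdditiveReduction` — `#Ẽ_ns(𝔽_p) = p` at additive reduction**
  (cusp clause of the tree's `natCard_point_of_Δ_eq_zero`; `ℤ_p/p ≅ ℤ/p`).

References: [SilvermanAEC2009] III.2.5 / Ex. 3.5, IV.3.2, VII.2.1, VII.5.1, VII.6.1, VII.6.3;
[Kim2022StructureSelmer] Lemma 3.10 (PDF p. 17).
-/

noncomputable section

open scoped Classical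

namespace Summit.BirchSwinnertonDyer.Rank1Residual.Additive.LocalLog

open Summit.BirchSwinnertonDyer.Rank1Residual.X11b.LocalIndex

variable {p : ℕ} [Fact p.Prime]

/-! ## §1 Integral equations: finiteness, `#E(ℚ_p)[p^∞] = p^t` -/

section Curve

open WeierstrassCurve

variable (X : WeierstrassCurve ℚ_[p]) [X.IsIntegral ℤ_[p]] [X.IsElliptic]

/-- The index `[E(ℚ_p) : E⁽²⁾(ℚ_p)]` is non-zero (finite index, tree
`finiteIndex_formalFiltration`). [cite: SilvermanAEC2009, VII.6.3] -/
theorem index_formalFiltration_two_ne_zero : (X.formalFiltration 2).index ≠ 0 :=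
  (X.finiteIndex_formalFiltration 2).index_ne_zero

/-- The torsion subgroup of `E(ℚ_p)` is finite (it embeds in `E(ℚ_p)/E⁽²⁾(ℚ_p)`).
[cite: SilvermanAEC2009, VII.6.3] -/
theorem finite_torsion_point : Finite (AddCommGroup.torsion X.toAffine.Point) := by
  haveI := X.finiteIndex_formalFiltration 2
  obtain ⟨φ₂, -⟩ := exists_formalFiltration_two_addEquiv X
  exact finite_torsion (X.formalFiltration 2) φ₂

/-- `v_p(N' · p^i) = i` for `p ∤ N'`. [folklore] -/
theorem padicValNat_mul_pow_eq {N' i : ℕ} (hN' : ¬ p ∣ N') : padicValNat p (N' * p ^ i) = i := by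
  have h0 : N' ≠ 0 := by rintro rfl; exact hN' (dvd_zero p)
  rw [padicValNat.mul h0 (pow_ne_zero i (Fact.out : p.Prime).ne_zero), padicValNat.prime_pow,
    padicValNat.eq_zero_of_not_dvd hN', zero_add]

/-- **`#E(ℚ_p)[p^∞] = p^t` with `t = v_p #E(ℚ_p)_tors`**: the `p`-primary component of `E(ℚ_p)` (Kim's
`#H⁰(ℚ_p, E[p^∞]) = p^t`; Mathlib `AddCommGroup.primaryComponent`) is that of the finite torsion
subgroup, of order `p^{v_p #E(ℚ_p)_tors}` (tree `card_addPrimaryComponent_eq_pow`, x11b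
`natCard_primaryComponent_torsion`). [cite: Kim2022StructureSelmer, Lemma 3.10 (PDF p. 17)] -/
theorem natCard_primaryComponent_point_eq_pow :
    Nat.card (AddCommGroup.primaryComponent X.toAffine.Point p) =
      p ^ padicValNat p (Nat.card (AddCommGroup.torsion X.toAffine.Point)) := by
  haveI := finite_torsion_point X
  rw [← natCard_primaryComponent_torsion X.toAffine.Point p,
    Literature.NumberTheory.EllipticCurves.card_addPrimaryComponent_eq_pow, Nat.factorization_def _ (Fact.out : p.Prime)]

end Curve

/-! ## §2 Minimal equations: `[E(ℚ_p) : E⁽²⁾(ℚ_p)] = c_p · #Ẽ_ns(𝔽_p) · p`; additive reduction: `#Ẽ_ns(𝔽_p) = p` -/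

section Minimal

open WeierstrassCurve

variable (X : WeierstrassCurve ℚ_[p]) [X.IsMinimal ℤ_[p]] [X.IsElliptic]

/-- `[E(ℚ_p) : E⁽²⁾(ℚ_p)] = c_p · #Ẽ_ns(𝔽_p) · p` for a minimal equation (tree
`index_formalFiltration`, `n = 2`). [cite: SilvermanAEC2009, VII.2 Prop. 2.1, IV.3.2(a), VII.6.1] -/
theorem index_formalFiltration_two_eq :
    (X.formalFiltration 2).index =
      X.localTamagawaNumber ℤ_[p] * Nat.card (X.reduction ℤ_[p]).toAffine.Point * p := by
  rw [X.index_formalFiltration (by norm_num : 1 ≤ 2), pow_one]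

/-- `c_p ≠ 0` and `#Ẽ_ns(𝔽_p) ≠ 0` (the index `[E(ℚ_p) : E⁽²⁾(ℚ_p)]` is finite and non-zero).
[cite: SilvermanAEC2009, VII.6.1 and VII.6.3] -/
theorem localTamagawaNumber_ne_zero_and_natCard_point_reduction_ne_zero :
    X.localTamagawaNumber ℤ_[p] ≠ 0 ∧ Nat.card (X.reduction ℤ_[p]).toAffine.Point ≠ 0 := by
  have h := index_formalFiltration_two_ne_zero X
  rw [index_formalFiltration_two_eq] at h
  exact ⟨fun h0 => h (by rw [h0, zero_mul, zero_mul]), fun h0 => h (by rw [h0, mul_zero, zero_mul])⟩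

/-- `v_p [E(ℚ_p) : E⁽²⁾(ℚ_p)] = v_p c_p + v_p #Ẽ_ns(𝔽_p) + 1`. [cite: SilvermanAEC2009, VII.2 Prop. 2.1, IV.3.2(a), VII.6.1] -/
theorem padicValNat_index_formalFiltration_two :
    padicValNat p (X.formalFiltration 2).index =
      padicValNat p (X.localTamagawaNumber ℤ_[p]) +
        padicValNat p (Nat.card (X.reduction ℤ_[p]).toAffine.Point) + 1 := by
  obtain ⟨h1, h2⟩ := localTamagawaNumber_ne_zero_and_natCard_point_reduction_ne_zero X
  rw [index_formalFiltration_two_eq, padicValNat.mul (mul_ne_zero h1 h2) (Fact.out : p.Prime).ne_zero,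
    padicValNat.mul h1 h2, padicValNat.self (Fact.out : p.Prime).one_lt]

end Minimal

section Additive

open WeierstrassCurve IsLocalRing

variable (X : WeierstrassCurve ℚ_[p]) [hadd : X.HasAdditiveReduction ℤ_[p]] [X.IsElliptic]

omit [X.IsElliptic] in
/-- At ADDITIVE reduction the reduced cubic is a CUSP: `Δ̃ = 0` and `c̃₄ = 0`.
[cite: SilvermanAEC2009, VII.5 Prop. 5.1(c)] -/
theorem reduction_Δ_eq_zero_and_c₄_eq_zero_of_hasAdditiveReduction :
    (X.reduction ℤ_[p]).Δ = 0 ∧ (X.reduction ℤ_[p]).c₄ = 0 := by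
  have hΔ := hadd.badReduction
  have hc₄ := hadd.additiveReduction
  rw [← integralModel_Δ_eq ℤ_[p] X] at hΔ
  rw [← integralModel_c₄_eq ℤ_[p] X] at hc₄
  refine ⟨?_, ?_⟩
  · rw [WeierstrassCurve.reduction, map_Δ, residue_eq_zero_iff]
    exact (IsDedekindDomain.HeightOneSpectrum.valuation_lt_one_iff_mem _ _).mp hΔ
  · rw [WeierstrassCurve.reduction, map_c₄, residue_eq_zero_iff]
    exact (IsDedekindDomain.HeightOneSpectrum.valuation_lt_one_iff_mem _ _).mp hc₄

omit [X.IsElliptic] in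
/-- **`#Ẽ_ns(𝔽_p) = p` at ADDITIVE reduction**: the nonsingular points of a cuspidal cubic over
`𝔽_p` form a group of order `p` (`Ẽ_ns ≅ 𝔾_a`; tree `natCard_point_of_Δ_eq_zero`, cusp clause;
`𝓞/𝔪 = ℤ_p/p ≅ ℤ/p`). [cite: SilvermanAEC2009, Prop. III.2.5 and Exercise 3.5 (PDF pp. 59, 97)] -/
theorem natCard_point_reduction_of_hasAdditiveReduction :
    Nat.card (X.reduction ℤ_[p]).toAffine.Point = p := by
  obtain ⟨hΔ, hc₄⟩ := reduction_Δ_eq_zero_and_c₄_eq_zero_of_hasAdditiveReduction X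
  haveI : Finite (ResidueField ℤ_[p]) := Finite.of_equiv (ZMod p) (PadicInt.residueField (p := p)).symm.toEquiv
  rw [((X.reduction ℤ_[p]).natCard_point_of_Δ_eq_zero hΔ).2.2 hc₄,
    Nat.card_congr (PadicInt.residueField (p := p)).toEquiv, Nat.card_zmod]

end Additive

end Summit.BirchSwinnertonDyer.Rank1Residual.Additive.LocalLog

end
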